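import Literature.Probability.Percolation.HalfPlaneOneArmQuasiMultiplicativity
import Literature.Probability.Percolation.HalfPlaneArmAxisInputs
import Literature.Probability.Percolation.AnnulusCrossingBoundProofs

/-!
# Stub `stub_clusterLocalityV2` of line `rainbow-monomials-in-excursion-kernels` — Part 10:
# the percolation half P1 for the family `(2;2)`, step 1 — two half-plane arms from the scale
# `k` to the scale `N` cost `o(1) · P[u ↔ w]` (crux `BoundaryDefectGaussianR`,
# stmt-CriticalPhenomena-14132)

Critical bond percolation on `ℤ²` (`bondPercolation (zdGraph 2) half`) in the discrete upper
half-plane `{v 1 ≥ 0}`; `hbox[n] = {0 ≤ v 1, max |v 0| (v 1) ≤ n}` is the half-box of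
half-plane radius `n` about the origin, `Arm[u, n]` the event that `u` is joined inside `hbox[n]`
by an open path to the level `{max |v 0| (v 1) = n}`, and `E[r, R]` the event that the
half-annulus `{0 ≤ v 1, r ≤ max |v 0| (v 1) ≤ R}` is crossed by an open path from its inner to
its outer level. For two row points `u, w` (`u 1 = w 1 = 0`, `|u 0|, |w 0| ≤ k`) we prove:

* `twoArm_glue`, `real_twoArm_le_conn` — GLUING LOWER BOUND (A): the two arms `Arm[u, 4k]`,
  `Arm[w, 4k]` and a U of three open box crossings at scale `2k` (probability `≥ c` by RSW and
  Harris–FKG, `HalfPlaneArm.real_U_ge`) join `u` to `w` inside `hbox[4k]`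
  (`HalfPlaneArm.glue`), so `c · P[Arm[u, 4k] ∩ Arm[w, 4k]] ≤ P[u ↔ w in hbox[4k]]`;
* `arm_split`, `real_twoArm_le_mul` — INDEPENDENCE UPPER BOUND (B): both arms to the level `R`
  contain arms to the level `r` and a crossing of the half-annulus `(r, R]`, events determined
  by disjoint sets of edges: `P[Arm[u, R] ∩ Arm[w, R]] ≤ P[Arm[u, r] ∩ Arm[w, r]] · P[E[r+1, R]]`;
* `real_E_le_pow` — DECAY: `P[E[n₀, R]] ≤ (1 - ε)^J` once `n₀ 2^(J+1) ≤ R`, `n₀ ≥ 32` (the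
  crossing passes `J` independent thin square annuli, each blocked with probability `≥ ε` by
  RSW: `openCrossing_subset_iInter_compl_thinAnnulusBlocked`,
  `real_iInter_compl_thinAnnulusBlocked_half_le`);
* `twoArm_bound` (registered sub-goal `s12_twoArmBound`) — the assembly
  `P[Arm[u, N] ∩ Arm[w, N]] ≤ ((1 - ε)^J / c) · P[u ↔ w in hbox[N]]` for `k ≥ k₀`,
  `(4k + 1) 2^(J+1) ≤ N`: two half-plane arms from the scale of the points to a far level are
  negligible against the connection probability, uniformly in the scale. [folklore]
-/

noncomputable section

namespace Summit.CriticalPhenomena.CardyFormulaZ2.Cruxes.BoundaryDefectGaussianR.RainbowMonomialsInExcursionKernels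

open MeasureTheory Set Literature.Probability.Percolation Literature.Probability.LatticeModels

local notation3 "hbox[" n "]" => {v : Site 2 | 0 ≤ v 1 ∧ max |v 0| (v 1) ≤ n}
local notation3 "lvl[" n "]" => {v : Site 2 | max |v 0| (v 1) = n}
local notation3 "Arm[" u ", " n "]" => openCrossing hbox[n] {u} lvl[n]
local notation3 "hann[" r ", " R "]" => {v : Site 2 | 0 ≤ v 1 ∧ r ≤ max |v 0| (v 1) ∧ max |v 0| (v 1) ≤ R}
local notation3 "E[" r ", " R "]" => openCrossing hann[r, R] lvl[r] lvl[R]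
local notation3 "U0[" a "]" =>
  openCrossing {v : Site 2 | (0 : Site 2) 0 + a ≤ v 0 ∧ v 0 ≤ (0 : Site 2) 0 + 2 * a ∧ 0 ≤ v 1 ∧
      v 1 ≤ (0 : Site 2) 1 + 2 * a} {v : Site 2 | v 1 = 0} {v : Site 2 | v 1 = (0 : Site 2) 1 + 2 * a} ∩
    openCrossing {v : Site 2 | (0 : Site 2) 0 - 2 * a ≤ v 0 ∧ v 0 ≤ (0 : Site 2) 0 + 2 * a ∧
      (0 : Site 2) 1 + a ≤ v 1 ∧ v 1 ≤ (0 : Site 2) 1 + 2 * a} {v : Site 2 | v 0 = (0 : Site 2) 0 - 2 * a}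
      {v : Site 2 | v 0 = (0 : Site 2) 0 + 2 * a} ∩
    openCrossing {v : Site 2 | (0 : Site 2) 0 - 2 * a ≤ v 0 ∧ v 0 ≤ (0 : Site 2) 0 - a ∧ 0 ≤ v 1 ∧
      v 1 ≤ (0 : Site 2) 1 + 2 * a} {v : Site 2 | v 1 = 0} {v : Site 2 | v 1 = (0 : Site 2) 1 + 2 * a}
local notation3 "μ" => bondPercolation (zdGraph 2) half

/-! ### The half-plane norm and the finiteness of the regions -/

/-- The half-plane norm `max |v 0| (v 1)` moves by at most one along an edge of `ℤ²`. [folklore] -/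
theorem hnorm_le_of_adj (u v : Site 2) (h : (zdGraph 2).Adj u v) :
    max |v 0| (v 1) ≤ max |u 0| (u 1) + 1 := by
  have := HalfPlaneArm.norm_le_of_adj (X := fun v : Site 2 => v 0) (Y := fun v : Site 2 => v 1)
    HalfPlaneArm.axis_X_le HalfPlaneArm.axis_Y_le 0 u v h
  simpa using this

/-- The half-box `hbox[n]` is finite. [folklore] -/
theorem hbox_finite (n : ℤ) : (hbox[n]).Finite := by
  refine (HalfPlaneArm.box_finite (X := fun v : Site 2 => v 0) (Y := fun v : Site 2 => v 1)
    HalfPlaneArm.axis_injective (-n) n 0 n).subset fun _ hv => ?_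
  obtain ⟨h0, h1⟩ := hv
  rw [max_le_iff, abs_le] at h1
  exact ⟨h1.1.1, h1.1.2, h0, h1.2⟩

/-- The half-annulus `hann[r, R]` is finite. [folklore] -/
theorem hann_finite (r R : ℤ) : (hann[r, R]).Finite :=
  (hbox_finite R).subset fun _ hv => ⟨hv.1, hv.2.2⟩

/-! ### (A) Gluing two arms through a U of box crossings -/

/-- **Deterministic gluing of two arms.** On a lattice configuration in the U event `U0[2k]`
(open top–bottom crossings of the pillars `[2k, 4k] × [0, 4k]`, `[-4k, -2k] × [0, 4k]` and an
open left–right crossing of the bar `[-4k, 4k] × [2k, 4k]`), two open arms inside `hbox[4k]`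
from points `u`, `w` of half-plane norm `≤ 2k` to the level `4k` are joined to each other: `u ↔ w`
inside `hbox[4k]` (`HalfPlaneArm.glue` for the axis coordinates). [folklore] -/
theorem twoArm_glue {ω : BondConfig (Site 2)} (hω : ω ⊆ (zdGraph 2).edgeSet) {k : ℤ} (hk : 1 ≤ k)
    (hU : ω ∈ U0[2 * k]) {u w : Site 2} (hu : max |u 0| (u 1) ≤ 2 * k) (hw : max |w 0| (w 1) ≤ 2 * k)
    (hAu : ω ∈ Arm[u, 4 * k]) (hAw : ω ∈ Arm[w, 4 * k]) : ω ∈ openConnIn hbox[4 * k] u w := by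
  obtain ⟨x, hx, y, hy, hxy⟩ := hAu
  obtain ⟨x', hx', y', hy', hxy'⟩ := hAw
  rw [mem_singleton_iff] at hx hx'
  subst hx hx'
  have hy : max |y 0| (y 1) = 4 * k := hy
  have hy' : max |y' 0| (y' 1) = 4 * k := hy'
  have hs2 : (0 : ℝ) < Real.sqrt 2 := by positivity
  have g := HalfPlaneArm.glue (X := fun v : Site 2 => v 0) (Y := fun v : Site 2 => v 1)
    HalfPlaneArm.axis_X_le HalfPlaneArm.axis_Y_le (emb := squareLatticeEmbedding)
    isIsoradial_squareLatticeEmbedding_holds isRhombicTiling_squareLatticeEmbedding_holds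
    (κ := Real.sqrt 2) hs2 HalfPlaneArm.axis_re HalfPlaneArm.axis_im hω (b := 0) (by simp)
    (a := 2 * k) (by omega) hU (S := hbox[4 * k]) (fun v hv => hv.1) hxy (by simpa using hu)
    (by simp only [Pi.zero_apply, sub_zero]; omega) (S' := hbox[4 * k]) (fun v hv => hv.1) hxy'
    (by simpa using hw) (by simp only [Pi.zero_apply, sub_zero]; omega)
  refine openConnIn_mono ?_ _ _ g
  rintro v ((hv | hv) | hv)
  · exact hv
  · exact hv
  · simp only [Pi.zero_apply, zero_sub, zero_add, mem_setOf_eq] at hv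
    refine ⟨hv.2.2.1, ?_⟩
    rw [max_le_iff, abs_le]
    omega

/-- Harris–FKG in the form used for gluing: if `A`, `U` are increasing measurable events,
`P(U) ≥ c` and `A ∩ U ⊆ B` almost surely, then `c · P(A) ≤ P(B)`. [folklore] -/
theorem harris_glue {A U B : Set (BondConfig (Site 2))} (hA : IsUpperSet A) (hUu : IsUpperSet U)
    (hAm : MeasurableSet A) (hUm : MeasurableSet U) {c : ℝ} (hc : c ≤ (μ).real U)
    (hsub : ∀ᵐ ω ∂(μ), ω ∈ A ∩ U → ω ∈ B) : c * (μ).real A ≤ (μ).real B := by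
  calc c * (μ).real A = (μ).real A * c := mul_comm _ _
    _ ≤ (μ).real A * (μ).real U := by gcongr
    _ ≤ (μ).real (A ∩ U) := harris_fkg_holds (zdGraph 2) half hA hUu hAm hUm
    _ ≤ (μ).real B := ENNReal.toReal_mono (measure_ne_top _ _) (measure_mono_ae hsub)

/-- **(A) The gluing lower bound.** There are `c > 0` and `k₀` such that for all `k ≥ k₀` and all
points `u`, `w` of the half-plane of half-plane norm `≤ 2k`,
`c · P[Arm[u, 4k] ∩ Arm[w, 4k]] ≤ P[u ↔ w in hbox[4k]]` (the U of `twoArm_glue` has probability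
`≥ c` by `HalfPlaneArm.real_U_ge`, i.e. RSW and Harris–FKG; Harris–FKG once more). [folklore] -/
theorem real_twoArm_le_conn : ∃ c : ℝ, 0 < c ∧ ∃ k₀ : ℕ, ∀ k : ℕ, k₀ ≤ k → ∀ u w : Site 2,
    max |u 0| (u 1) ≤ 2 * k → max |w 0| (w 1) ≤ 2 * k →
    c * (μ).real (Arm[u, 4 * (k : ℤ)] ∩ Arm[w, 4 * (k : ℤ)]) ≤
      (μ).real (openConnIn hbox[4 * (k : ℤ)] u w) := by
  obtain ⟨cU, hcU, mU, hUge⟩ := HalfPlaneArm.real_U_ge (X := fun v : Site 2 => v 0)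
    (Y := fun v : Site 2 => v 1) HalfPlaneArm.axis_X_le HalfPlaneArm.axis_Y_le
    HalfPlaneArm.axis_injective half HalfPlaneArm.axis_rswLR HalfPlaneArm.axis_rswTB
  refine ⟨cU, hcU, mU + 1, fun k hk u w hu hw => ?_⟩
  have hk1 : (1 : ℤ) ≤ k := by exact_mod_cast (show 1 ≤ k by omega)
  have hkU : (mU : ℤ) ≤ 2 * k := by
    have : (mU : ℤ) ≤ k := by exact_mod_cast (show mU ≤ k by omega)
    omega
  have eU := hUge 0 (2 * k) (by simp) hkU (by simp only [Pi.zero_apply]; omega)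
  have finB := HalfPlaneArm.box_finite (X := fun v : Site 2 => v 0) (Y := fun v : Site 2 => v 1)
    HalfPlaneArm.axis_injective
  refine harris_glue ((isUpperSet_openCrossing _ _ _).inter (isUpperSet_openCrossing _ _ _))
    (((isUpperSet_openCrossing _ _ _).inter (isUpperSet_openCrossing _ _ _)).inter
      (isUpperSet_openCrossing _ _ _))
    ((HalfPlaneArm.measurableSet_openCrossing_of_finite (hbox_finite _) _ _).inter
      (HalfPlaneArm.measurableSet_openCrossing_of_finite (hbox_finite _) _ _))
    (((HalfPlaneArm.measurableSet_openCrossing_of_finite (finB _ _ _ _) _ _).inter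
      (HalfPlaneArm.measurableSet_openCrossing_of_finite (finB _ _ _ _) _ _)).inter
      (HalfPlaneArm.measurableSet_openCrossing_of_finite (finB _ _ _ _) _ _)) eU ?_
  filter_upwards [ae_subset_edgeSet (zdGraph 2) half] with ω hω h
  exact twoArm_glue hω hk1 h.2 hu hw h.1.1 h.1.2

/-! ### (B) Independence: arms to a far level split into near arms and a half-annulus crossing -/

/-- **Deterministic splitting of an arm.** On a lattice configuration, an open arm inside
`hbox[R]` from `u` (of half-plane norm `≤ r`) to the level `R ≥ r + 1` contains an arm to the
level `r` inside `hbox[r]` (first visit) and an open crossing of the half-annulus `hann[r+1, R]`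
(clipping to the window `r + 1 ≤ · ≤ R` of the `1`-Lipschitz half-plane norm). [folklore] -/
theorem arm_split {ω : BondConfig (Site 2)} (hω : ω ⊆ (zdGraph 2).edgeSet) {u : Site 2} {r R : ℤ}
    (hu : max |u 0| (u 1) ≤ r) (hrR : r + 1 ≤ R) (h : ω ∈ Arm[u, R]) :
    ω ∈ Arm[u, r] ∩ E[r + 1, R] := by
  obtain ⟨x, hx, y, hy, hxy⟩ := h
  rw [mem_singleton_iff] at hx
  subst hx
  have hy : max |y 0| (y 1) = R := hy
  constructor
  · obtain ⟨z, hz, hconn⟩ := exists_openConnIn_le_level hω (fun v : Site 2 => max |v 0| (v 1))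
      hnorm_le_of_adj r hu (by omega) hxy
    refine ⟨x, mem_singleton _, z, hz, openConnIn_mono ?_ _ _ hconn⟩
    exact fun v hv => ⟨hv.1.1, hv.2⟩
  · obtain ⟨x', y', hx', hy', hconn⟩ := exists_openConnIn_clip hω (fun v : Site 2 => max |v 0| (v 1))
      hnorm_le_of_adj (a := r + 1) (b := R) hrR (by omega) hy.ge hxy
    refine ⟨x', hx', y', hy', openConnIn_mono ?_ _ _ hconn⟩
    exact fun v hv => ⟨hv.1.1, hv.2.1, hv.2.2⟩

/-- **(B) The independence upper bound**: for points `u`, `w` of half-plane norm `≤ r` and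
`r + 1 ≤ R`, `P[Arm[u, R] ∩ Arm[w, R]] ≤ P[Arm[u, r] ∩ Arm[w, r]] · P[E[r + 1, R]]` — the near arms
and the half-annulus crossing of `arm_split` are determined by the edges inside the disjoint
regions `hbox[r]`, `hann[r + 1, R]`, hence independent under the product measure. [folklore] -/
theorem real_twoArm_le_mul (u w : Site 2) {r R : ℤ} (hu : max |u 0| (u 1) ≤ r)
    (hw : max |w 0| (w 1) ≤ r) (hrR : r + 1 ≤ R) :
    (μ).real (Arm[u, R] ∩ Arm[w, R]) ≤ (μ).real (Arm[u, r] ∩ Arm[w, r]) * (μ).real E[r + 1, R] := by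
  have hdisj : Disjoint (hbox[r]) (hann[r + 1, R]) := by
    rw [Set.disjoint_left]
    rintro v ⟨-, hv⟩ ⟨-, hv', -⟩
    omega
  rw [← bondPercolation_real_inter_of_disjoint (zdGraph 2) half (HalfPlaneArm.disjoint_pairs hdisj)
    ((HalfPlaneArm.determinedBy_openCrossing_of_finite (hbox_finite r) _ _).inter
      (HalfPlaneArm.determinedBy_openCrossing_of_finite (hbox_finite r) _ _))
    (HalfPlaneArm.determinedBy_openCrossing_of_finite (hann_finite (r + 1) R) _ _)
    ((HalfPlaneArm.measurableSet_openCrossing_of_finite (hbox_finite r) _ _).inter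
      (HalfPlaneArm.measurableSet_openCrossing_of_finite (hbox_finite r) _ _))
    (HalfPlaneArm.measurableSet_openCrossing_of_finite (hann_finite (r + 1) R) _ _)]
  refine ENNReal.toReal_mono (measure_ne_top _ _) (measure_mono_ae ?_)
  filter_upwards [ae_subset_edgeSet (zdGraph 2) half] with ω hω h
  have h1 := arm_split hω hu hrR h.1
  have h2 := arm_split hω hw hrR h.2
  exact ⟨⟨h1.1, h2.1⟩, h1.2⟩

/-! ### Decay of half-annulus crossings -/

/-- **Decay of half-annulus crossings.** There is `ε ∈ (0, 1]` such that for all `n₀ ≥ 32`, all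
`J` and all `R ≥ n₀ 2^(J+1)`, `P[E[n₀, R]] ≤ (1 - ε)^J`: an open crossing of `hann[n₀, R]` is an
open path from the box `B(n₀)` to sup-norm distance `≥ R`, beyond the `J`-th annulus of the
doubling family of thin square annuli started at `n₀`, none of which may then be blocked by a
closed dual circuit — `J` independent events of probability `≤ 1 - ε` each (RSW).
[cite: BollobasRiordan2006, Ch. 3, proof of Thm. 6] -/
theorem real_E_le_pow : ∃ ε : ℝ, 0 < ε ∧ ε ≤ 1 ∧ ∀ (n₀ J : ℕ) (R : ℤ), 32 ≤ n₀ →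
    (n₀ : ℤ) * 2 ^ (J + 1) ≤ R → (μ).real E[(n₀ : ℤ), R] ≤ (1 - ε) ^ J := by
  obtain ⟨ε, hε, hεn⟩ := exists_pos_le_real_thinAnnulusBlocked_half
  refine ⟨ε, hε, (hεn 32 le_rfl).trans measureReal_le_one, fun n₀ J R hn₀ hR => ?_⟩
  set M : ℕ := n₀ * 2 ^ (J - 1) + 3 * (n₀ * 2 ^ (J - 1)) / 8 with hM
  have hMR : (M : ℤ) ≤ R := by
    have h1 : n₀ * 2 ^ (J - 1) ≤ n₀ * 2 ^ J :=
      Nat.mul_le_mul_left _ (Nat.pow_le_pow_right (by norm_num) (by omega))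
    have h2 : M ≤ n₀ * 2 ^ (J + 1) := by
      have h3 : n₀ * 2 ^ (J + 1) = 2 * (n₀ * 2 ^ J) := by ring
      rw [h3]
      omega
    calc (M : ℤ) ≤ ((n₀ * 2 ^ (J + 1) : ℕ) : ℤ) := by exact_mod_cast h2
      _ = (n₀ : ℤ) * 2 ^ (J + 1) := by push_cast; ring
      _ ≤ R := hR
  calc (μ).real E[(n₀ : ℤ), R]
      ≤ (μ).real (openCrossing univ ↑(box 2 n₀) {w : Site 2 | ¬ ∀ i, -(M : ℤ) < w i ∧ w i < M}) := by
        refine measureReal_mono ?_ (measure_ne_top _ _)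
        rintro ω ⟨x, hx, y, hy, hxy⟩
        have hx : max |x 0| (x 1) = n₀ := hx
        have hy : max |y 0| (y 1) = R := hy
        have hx0 : 0 ≤ x 1 := hxy.1.1
        refine ⟨x, ?_, y, ?_, openConnIn_mono (subset_univ _) _ _ hxy⟩
        · rw [Finset.mem_coe, mem_box, Fin.forall_fin_two]
          have h1 : |x 0| ≤ n₀ := hx ▸ le_max_left _ _
          have h2 : x 1 ≤ n₀ := hx ▸ le_max_right _ _
          rw [abs_le] at h1
          omega
        · simp only [mem_setOf_eq, Fin.forall_fin_two, not_and_or, not_lt]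
          rcases le_total |y 0| (y 1) with h | h
          · rw [max_eq_right h] at hy
            omega
          · rw [max_eq_left h] at hy
            rcases (abs_eq (show (0 : ℤ) ≤ R by omega)).1 hy with h' | h' <;> omega
    _ ≤ (μ).real (⋂ j ∈ Finset.range J, (thinAnnulusBlocked (n₀ * 2 ^ j) (3 * (n₀ * 2 ^ j) / 8))ᶜ) := by
        refine ENNReal.toReal_mono (measure_ne_top _ _) (measure_mono_ae ?_)
        filter_upwards [ae_subset_edgeSet (zdGraph 2) half] with ω hω hmem
        exact openCrossing_subset_iInter_compl_thinAnnulusBlocked hω hn₀ hmem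
    _ ≤ (1 - ε) ^ J := real_iInter_compl_thinAnnulusBlocked_half_le hεn hn₀ J

/-! ### Assembly: two far arms are negligible against the connection -/

/-- **Two half-plane arms from the scale of the points to a far level are negligible against the
connection probability.** There are `c > 0`, `ε ∈ (0, 1]` and `k₀ ≥ 1` such that for all
`k ≥ k₀`, `J`, `N` with `(4k + 1) 2^(J+1) ≤ N` and all row points `u, w` (`u 1 = w 1 = 0`,
`|u 0|, |w 0| ≤ k`): `P[Arm[u, N] ∩ Arm[w, N]] ≤ ((1 - ε)^J / c) · P[u ↔ w in hbox[N]]`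
((B) at the levels `4k < N`, the decay of `E[4k + 1, N]`, and (A)). [folklore] -/
theorem twoArm_bound : ∃ c : ℝ, 0 < c ∧ ∃ ε : ℝ, 0 < ε ∧ ε ≤ 1 ∧ ∃ k₀ : ℕ, 1 ≤ k₀ ∧
    ∀ k J N : ℕ, k₀ ≤ k → (4 * k + 1) * 2 ^ (J + 1) ≤ N → ∀ u w : Site 2, u 1 = 0 → w 1 = 0 →
    |u 0| ≤ k → |w 0| ≤ k →
    (μ).real (Arm[u, (N : ℤ)] ∩ Arm[w, (N : ℤ)]) ≤
      (1 - ε) ^ J / c * (μ).real (openConnIn hbox[(N : ℤ)] u w) := by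
  obtain ⟨c, hc, k₁, hA⟩ := real_twoArm_le_conn
  obtain ⟨ε, hε, hε1, hC⟩ := real_E_le_pow
  refine ⟨c, hc, ε, hε, hε1, max k₁ 8, le_max_of_le_right (by norm_num),
    fun k J N hk hN u w hu1 hw1 hu hw => ?_⟩
  have hk₁ : k₁ ≤ k := le_trans (le_max_left _ _) hk
  have hk8 : (8 : ℤ) ≤ k := by exact_mod_cast le_trans (le_max_right _ _) hk
  have hνu : max |u 0| (u 1) ≤ k := by rw [hu1]; exact max_le hu (by positivity)
  have hνw : max |w 0| (w 1) ≤ k := by rw [hw1]; exact max_le hw (by positivity)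
  have hN' : ((4 * k + 1 : ℕ) : ℤ) * 2 ^ (J + 1) ≤ N := by exact_mod_cast hN
  have hN2 : 2 * (4 * (k : ℤ) + 1) ≤ N := by
    have h2 : (2 : ℤ) ≤ 2 ^ (J + 1) := by
      calc (2 : ℤ) = 2 ^ 1 := by norm_num
        _ ≤ 2 ^ (J + 1) := pow_le_pow_right₀ (by norm_num) (by omega)
    have : ((4 * k + 1 : ℕ) : ℤ) * 2 ≤ ((4 * k + 1 : ℕ) : ℤ) * 2 ^ (J + 1) :=
      mul_le_mul_of_nonneg_left h2 (by positivity)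
    push_cast at this hN'
    linarith
  have step1 := real_twoArm_le_mul u w (r := 4 * k) (R := N) (by omega) (by omega) (by omega)
  have step2 := hA k hk₁ u w (by omega) (by omega)
  have step3 : (μ).real E[4 * (k : ℤ) + 1, (N : ℤ)] ≤ (1 - ε) ^ J := by
    have h := hC (4 * k + 1) J N (by omega) hN'
    have e : ((4 * k + 1 : ℕ) : ℤ) = 4 * (k : ℤ) + 1 := by push_cast; ring
    rw [e] at h
    exact h
  have hsub : hbox[4 * (k : ℤ)] ⊆ hbox[(N : ℤ)] := fun v hv => ⟨hv.1, hv.2.trans (by omega)⟩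
  have step4 : (μ).real (openConnIn hbox[4 * (k : ℤ)] u w) ≤ (μ).real (openConnIn hbox[(N : ℤ)] u w) :=
    measureReal_mono (openConnIn_mono hsub u w) (measure_ne_top _ _)
  have hε0 : 0 ≤ (1 - ε) ^ J := pow_nonneg (by linarith) J
  calc (μ).real (Arm[u, (N : ℤ)] ∩ Arm[w, (N : ℤ)])
      ≤ (μ).real (Arm[u, 4 * (k : ℤ)] ∩ Arm[w, 4 * (k : ℤ)]) * (μ).real E[4 * (k : ℤ) + 1, (N : ℤ)] :=
        step1
    _ ≤ (μ).real (openConnIn hbox[4 * (k : ℤ)] u w) / c * (1 - ε) ^ J :=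
        mul_le_mul (by rw [le_div_iff₀ hc, mul_comm]; exact step2) step3 measureReal_nonneg
          (div_nonneg measureReal_nonneg hc.le)
    _ ≤ (μ).real (openConnIn hbox[(N : ℤ)] u w) / c * (1 - ε) ^ J := by gcongr
    _ = (1 - ε) ^ J / c * (μ).real (openConnIn hbox[(N : ℤ)] u w) := by ring

/-! ### Registered sub-goal of the stub carried by this file -/

/-- **Sub-goal `s12_twoArmBound`** (registered on stmt-CriticalPhenomena-14132; percolation half
P1 of `stub_clusterLocalityV2` for the family `(2;2)`, step 1): two half-plane arms from row
points at scale `k` to the level `N ≥ (4k + 1) 2^(J+1)` cost at most `(1 - ε)^J / c` times the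
connection probability inside the half-box of radius `N` (`twoArm_bound`). [folklore] -/
theorem s12_twoArmBound : ∃ c : ℝ, 0 < c ∧ ∃ ε : ℝ, 0 < ε ∧ ε ≤ 1 ∧ ∃ k₀ : ℕ, 1 ≤ k₀ ∧ ∀ k J N : ℕ, k₀ ≤ k → (4 * k + 1) * 2 ^ (J + 1) ≤ N → ∀ u w : Literature.Probability.LatticeModels.Site 2, u 1 = 0 → w 1 = 0 → |u 0| ≤ k → |w 0| ≤ k → (Literature.Probability.Percolation.bondPercolation (Literature.Probability.LatticeModels.zdGraph 2) Literature.Probability.Percolation.half).real (Literature.Probability.Percolation.openCrossing {v : Literature.Probability.LatticeModels.Site 2 | 0 ≤ v 1 ∧ max |v 0| (v 1) ≤ (N : ℤ)} {u} {v : Literature.Probability.LatticeModels.Site 2 | max |v 0| (v 1) = (N : ℤ)} ∩ Literature.Probability.Percolation.openCrossing {v : Literature.Probability.LatticeModels.Site 2 | 0 ≤ v 1 ∧ max |v 0| (v 1) ≤ (N : ℤ)} {w} {v : Literature.Probability.LatticeModels.Site 2 | max |v 0| (v 1) = (N : ℤ)}) ≤ (1 - ε) ^ J / c * (Literature.Probability.Percolation.bondPercolation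 (Literature.Probability.LatticeModels.zdGraph 2) Literature.Probability.Percolation.half).real (Literature.Probability.Percolation.openConnIn {v : Literature.Probability.LatticeModels.Site 2 | 0 ≤ v 1 ∧ max |v 0| (v 1) ≤ (N : ℤ)} u w) :=
  twoArm_bound

end Summit.CriticalPhenomena.CardyFormulaZ2.Cruxes.BoundaryDefectGaussianR.RainbowMonomialsInExcursionKernels

end
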